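import Summits.AtomisticToContinuum.BoseEinsteinCondensation.Theses.BECRiccatiGhostPlasma

/-!
# Crux `BeyondPairGhostWork` (stmt-AtomisticToContinuum-13505) — birth skeleton (BC3), line `birth-cavity-split`

Route: `route-AtomisticToContinuum-BECRiccatiGhostPlasma` (rank-2 crux, card crux P of
`riccati-cluster-ghost-plasma`; skeleton registrar planner-skel-stmt-AtomisticToContinuum-13505-0,
2026-08-17). The crux, fixed and concluded BY NAME below
(`Theses.BECRiccatiGhostPlasma.BeyondPairGhostWork`): for every BOUNDED repulsive finite-range `v`
there is `ρ₀ > 0` such that for `0 < ρ < ρ₀` there is ONE constant `C` with, eventually in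
`N = m + 2` (torus of side `L = (N/ρ)^{1/3}`), for every EXACT strictly positive translation-invariant
periodic ground state `Ψ = e^{−S}` and all `x, y`:
`∫_{cell^{m+1}} Ψ(x,Y)² {[S(y,Y) − S(x,Y)] − Σ_j [u_H(y,Y_j) − u_H(x,Y_j)]} dY ≤ C ∫_{cell^{m+1}} Ψ(x,Y)² dY`,
`u_H(x,z) = L^{−3m} ∫_{cell^m} S(x,z,W) dW` the uniform-measure (Hoeffding) pair projection of `S` —
the Palm mean (law `P_x` of the bath given a particle at `x`) of the BEYOND-PAIR ghost work of
teleporting the tagged particle `x → y` is bounded uniformly in `N` and in the separation.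

## Why the crux is hard (route header, why-might-fail of the crux)

Two independent dangers are recorded on the item. INFRARED: the three-body kernel of `S` has weight
`û₃ ∼ |k|⁻¹` with a direction-dependent `k₃ → 0` limit (three-phonon vertex; Berdahl1974,
CampbellFeenberg1969, Feenberg1969 App. 5-C), so the `k ≥ 3` Hoeffding components radiate
`1/r²`-class far fields whose Palm-mean WORK over separations `|x − y| ≲ L` might grow like `log L`
unless it is screened. ULTRAVIOLET: the UNIFORM projection `u_H` averages `S` over bath positions
with the flat measure, including core overlaps, and "may be the wrong renormalisation at strong
cores" — a danger that only materialises when a bath particle sits within a core distance of one of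
the two ghost end points. The two dangers live on DISJOINT parts of configuration space, and that
is the cut.

## The cut (two registered stubs, both load-bearing; composition = partition of the bath cell)

Fix a cavity radius `rc > 0` and the PERIODIC ISOLATION EVENT
`I_rc(x,y) = {Y ∈ (ℝ³)^{m+1} | ∀ j, ∀ n ∈ ℤ³, rc ≤ ‖Y_j − x − Ln‖ ∧ rc ≤ ‖Y_j − y − Ln‖}` (no bath
particle within torus-distance `rc` of either end point; torus distance, not Euclidean, so that an
end point near a face of the cell is treated correctly).

* `stub_cavityWork` — INFRARED / screening stub (the HARDEST; open-problem size): `∃ rc > 0`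
  (prover's choice, expected `rc = R₀` = range of `v`, so that on `I_rc` the tagged particle feels no
  direct potential at either end point) `∃ ρ₀ ∀ ρ < ρ₀ ∃ C ∀ᶠ m ∀ Ψ ∀ x y`:
  `∫_{cell^{m+1} ∩ I_rc} f ≤ C · Z` (`f` = the crux's integrand, `Z = ∫_{cell^{m+1}} Ψ(x,Y)² dY`).
  Cavity-to-cavity ghost transfer: only the FAR FIELDS of the beyond-pair kernels are probed at the
  end points — this is `KernelTailScreening` of the route's plan (ii) in a typed, kernel-free form.
  Why it might fail: exactly the crux's first clause (`log L` far-field work). Cheapest falsifier: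
  the route's VMC check (iv) restricted to isolated end points (`E_x[Δ − Δ_pair ; I_rc]` versus `L`
  at `ρa³ = 10⁻³`, `N = 64…512`): a `log L` drift kills the stub and the crux together.
* `stub_crowdedWork` — ULTRAVIOLET / strong-core stub (size M–L): `∀ rc > 0 ∃ ρ₀(v, rc) ∀ ρ < ρ₀ ∃ C
  ∀ᶠ m ∀ Ψ ∀ x y`: `∫_{cell^{m+1} ∖ I_rc} f ≤ C · Z`. The crowded event is RARE under `P_x`
  (probability `O(ρ rc³)` by a pinned one-body intensity bound) and ON it the beyond-pair increment
  of `S = −log Ψ` is a LOCAL quantity for a bounded potential (log-gradient / local Harnack control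
  of the positive solution of `(H − E₀)Ψ = 0` in the tagged coordinate at scale `rc`, uniformly in
  the bath, plus second Palm moments of the local particle number). `rc` is fixed BEFORE `ρ₀`, so
  the statement never degenerates into the crux (for fixed `rc`, `m → ∞` makes the crowded event a
  vanishing fraction of the cell; for large `rc` the prover takes `ρ₀(rc) ≲ 1/(K rc³)`). Why it
  might fail: a Palm second moment of the local particle number that is not uniform in `N` for the
  exact ground state (clumping near the tagged particle), or local log-gradient bounds for `S` that
  degrade with the number of bath particles inside the cavity. Cheapest falsifier: weak coupling
  `v = λv₀`, `N = 3` (`m = 1`, the first `N` with a nonzero beyond-pair part — for `m = 0` the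
  projection `u_H` IS `S` and `f ≡ 0`): `S` is an explicit Fourier sum to `O(λ²)` and the
  crowded-event Palm integral must come out `O(λ² ρ rc³)`, uniformly in the separation.

Composition: `BeyondPairGhostWork_of` (stub STATEMENTS ⟹ the crux by name): `rc` from Stub 1,
Stub 2 at that `rc`, `ρ₀ := min`, `C := |C₁| + |C₂|`, eventually `:=` intersection of the two `atTop`
sets; per `Ψ, x, y` the bath cell splits measurably (`measurableSet_isolated`) and the real-analysis
seam `setIntegral_le_of_inter_sdiff` adds the two ONE-SIDED bounds against the nonnegative slice
mass — by `integral_inter_add_sdiff` when the crux integrand is integrable on the cell, by the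
Bochner junk value otherwise (the crux's own integral is then `0 ≤ C·Z`). `BeyondPairGhostWork_of_stubs`
feeds the two registered stubs in; `sorry` occurs in the two stubs only.

Neither stub is comparable with the crux by cheap logic: each bounds the integral of a SIGNED density
over a sub-event (no monotonicity), Stub 1 has `∃ rc` and Stub 2 `∀ rc` BEFORE `ρ₀`, and the BC3
probes `stub → crux`, `stub → BoseEinsteinCondensation` by `exact? | simpa | simpa [defs] | aesop`
all fail (16/16, folder `bc/`, 2026-08-17).

Disproof used: none exists for this crux (`ledger crux ls stmt-AtomisticToContinuum-13505`: no
workfiles, no ideas, no `Disproof.lean`, no dead lines, 2026-08-17). Negatives index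
(`ledger negatives --problem AtomisticToContinuum`, 20 entries): the two BEC negatives (SwapJensen
stmt-3980 — a sign exploit on nonnegative-but-vanishing states; BerryStiffPhaseLRO stmt-14490 — an RG
constant scheme) are not restated: both stubs keep the crux's hypotheses `0 < re Ψ`, `im Ψ = 0`
(no vanishing states) and ask only for `C < ∞` on the bounding side. Corners: `v ≡ 0` (constant
ground state, `S` constant, `f ≡ 0`: both stubs with `C = 0`); `x = y` (`f ≡ 0`); `rc` larger than the
cell at small `m` (harmless: `∀ᶠ m`); end points outside the cell (periodicity of `Ψ` and the
torus distance make both statements `Lℤ³`-invariant in `x, y`); non-integrable integrand (junk `0`,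
handled in the seam, never used to prove anything).

References: Hoeffding1948 (canonical decomposition); Berdahl1974, CampbellFeenberg1969, Feenberg1969
§3.3–3.4 and App. 5-C (three-body kernel, three-phonon vertex); ReattoChester1967, Reatto1969,
McMillan1965 (ghost-particle / classical-shadow reading of the 1-pdm); BrydgesFederbush1980,
BrydgesMartin1999 (screening bookkeeping the far stub bets on); LSSY2005 (setting);
barrier `Literature.Barriers.AtomisticToContinuum.BogoliubovPerturbationInfraredNarrow` (its listed
infrared inputs are the non-divergent static ones; no expansion is used in either stub).
-/

noncomputable section

open MeasureTheory Filter
open scoped ENNReal NNReal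

namespace Summit.AtomisticToContinuum.BoseEinsteinCondensation.Cruxes.BeyondPairGhostWork.BirthCavitySplit

open Literature.MathematicalPhysics.QuantumManyBody.BoseGas

/-! ## Registered stubs

Notation used informally in the docstrings (everything is INLINED in the statements, over existing
declarations only). `N = m + 2` bosons on the torus of side `L = sideLength ρ (m + 2)` (`L³ = N/ρ`);
`Ψ` an EXACT, strictly positive, translation-invariant periodic ground state, `S = −log Ψ`; the
tagged particle sits in slot `0` (`Matrix.vecCons x Y`, bath `Y ∈ cell^(m+1)`);
`u_H(x, z) = L^(−3m) ∫_(cell^m) S(x, z, W) dW = (ρ/(m+2))^m ∫ …` is the uniform-measure (Hoeffding)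
pair projection of `S`; the BEYOND-PAIR GHOST-WORK DENSITY is the crux's integrand
`f(Y) = Ψ(x,Y)² · {[S(y,Y) − S(x,Y)] − Σ_j [u_H(y,Y_j) − u_H(x,Y_j)]}`, and `Z = ∫_(cell^(m+1)) Ψ(x,Y)² dY`
is the (`x`-independent) slice mass, so that `∫ f ≤ C·Z` reads `E_x[beyond-pair work x → y] ≤ C`
under the Palm law `P_x`. The PERIODIC ISOLATION EVENT at scale `rc` is
`I_rc(x, y) = {Y | ∀ j, ∀ n ∈ ℤ³, rc ≤ ‖Y_j − x − L n‖ ∧ rc ≤ ‖Y_j − y − L n‖}` — no bath particle within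
torus-distance `rc` of either ghost end point (both end points sit in CAVITIES of radius `rc`). -/

/-- **Stub 1 — cavity-to-cavity beyond-pair ghost work is bounded (the INFRARED / screening
stub; the HARDEST one).** For bounded admissible `v` there is a cavity radius `rc > 0` (prover's
choice: expected `rc = R₀`, the range of `v`, so that on `I_rc` the tagged particle feels NO direct
potential at either end point and the transfer `x → y` is pure correlation work) such that at all
small densities, with ONE constant `C`, eventually in `N`, for every exact positive
translation-invariant ground state and all `x, y`:
`∫_(cell^(m+1) ∩ I_rc(x,y)) f ≤ C · Z` — the Palm mean of the beyond-pair (Hoeffding `k ≥ 3`) ghost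
work RESTRICTED TO CONFIGURATIONS WHERE BOTH GHOST END POINTS ARE ISOLATED is bounded uniformly in
`N` and in the separation `|x − y| ≤ L√3/2`. This is where the crux's first why-might-fail lives
(three-phonon vertex `û₃ ∼ |k|⁻¹`, possible `log L` growth of the far-field work): on `I_rc` only the
FAR FIELDS of the `k ≥ 3` kernels are probed at the end points, so the stub is the statement that the
`1/r²`-class far fields radiated by the beyond-pair kernels (Berdahl1974, Feenberg1969 App. 5-C) are
SCREENED in Palm mean (Debye / Brydges–Federbush bookkeeping, plan (ii) `KernelTailScreening` of the
route header), with every ultraviolet question removed. Not comparable with the crux (restriction of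
a SIGNED density to a sub-event), easier in kind: no configuration with a bath particle on a core of
`x` or `y` enters. `v ≡ 0`: `S` constant, `f ≡ 0`, `C = 0`. Open-problem size. -/
theorem stub_cavityWork :
    ∀ v : ℝ → ℝ≥0∞, IsRepulsiveFiniteRange v → (∃ M : NNReal, ∀ r, v r ≤ M) →
      ∃ rc : ℝ, 0 < rc ∧ ∃ ρ₀ : ℝ, 0 < ρ₀ ∧ ∀ ρ : ℝ, 0 < ρ → ρ < ρ₀ → ∃ C : ℝ,
      ∀ᶠ m : ℕ in atTop, ∀ Ψ : PeriodicTrialState (m + 2) (sideLength ρ (m + 2)),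
      periodicEnergy v Ψ = periodicGroundStateEnergy v (m + 2) (sideLength ρ (m + 2)) →
      (∀ X, 0 < (Ψ.ψ X).re ∧ (Ψ.ψ X).im = 0) →
      (∀ (a : Space) (X : Config (m + 2)), Ψ.ψ (fun i => X i + a) = Ψ.ψ X) →
      ∀ x y : Space,
        (∫ Y in cellN (m + 1) (sideLength ρ (m + 2)) ∩
            {Y | ∀ (j : Fin (m + 1)) (n : Fin 3 → ℤ),
              rc ≤ ‖Y j - x - latticeVec (sideLength ρ (m + 2)) n‖ ∧
                rc ≤ ‖Y j - y - latticeVec (sideLength ρ (m + 2)) n‖},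
          (Ψ.ψ (Matrix.vecCons x Y)).re ^ 2 *
            ((Real.log ((Ψ.ψ (Matrix.vecCons x Y)).re) - Real.log ((Ψ.ψ (Matrix.vecCons y Y)).re)) -
              ∑ j : Fin (m + 1),
                ((ρ / ((m : ℝ) + 2)) ^ m *
                    (∫ W in cellN m (sideLength ρ (m + 2)),
                      -Real.log ((Ψ.ψ (Matrix.vecCons y (Matrix.vecCons (Y j) W))).re)) -
                  (ρ / ((m : ℝ) + 2)) ^ m *
                    (∫ W in cellN m (sideLength ρ (m + 2)),
                      -Real.log ((Ψ.ψ (Matrix.vecCons x (Matrix.vecCons (Y j) W))).re))))) ≤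
          C * ∫ Y in cellN (m + 1) (sideLength ρ (m + 2)), (Ψ.ψ (Matrix.vecCons x Y)).re ^ 2 := by
  sorry

/-- **Stub 2 — crowded configurations carry bounded beyond-pair ghost work (the ULTRAVIOLET /
strong-core stub).** For bounded admissible `v` and EVERY cavity radius `rc > 0` there is
`ρ₀ = ρ₀(v, rc) > 0` such that at all densities `ρ < ρ₀`, with one constant `C`, eventually in `N`,
for every exact positive translation-invariant ground state and all `x, y`:
`∫_(cell^(m+1) ∖ I_rc(x,y)) f ≤ C · Z` — the Palm mean of the beyond-pair ghost work restricted to the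
CROWDED event (some bath particle within torus-distance `rc` of `x` or of `y`) is bounded. Mechanism
foreseen: the crowded event is RARE under `P_x` (Palm probability at most
`E_x[#{j : dist(Y_j, {x,y}) < rc}] ≤ 2·(4π/3) rc³ · sup ρ_x^(1) = O(ρ rc³)` by a pinned one-body
(Ruelle-type) intensity bound), while ON it the beyond-pair increment of `S = −log Ψ` is controlled
by LOCAL regularity of the positive solution of `(H − E₀)Ψ = 0` at scale `rc` for a BOUNDED potential
(log-gradient / local Harnack control of `S` in the tagged coordinate, uniformly in the bath — the
bath enters only through the nonnegative, bounded, finite-range one-body potential it creates near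
`x` and `y`) together with second Palm moments of the local particle number. `rc` is fixed BEFORE
`ρ₀`, so for large `rc` the prover may take `ρ₀(rc) ≲ 1/(K rc³)`: the statement never degenerates
into the crux (for fixed `rc` and `m → ∞` the crowded event is a vanishing fraction of `cell^(m+1)`).
This is where the crux's second why-might-fail lives ("the UNIFORM projection may be the wrong
renormalisation at strong cores": `u_H(y, Y_j)` with `Y_j` on top of `y`). `v ≡ 0`: `f ≡ 0`, `C = 0`.
Size M–L (bounded `v`: every local quantity is finite; the issue is uniformity in `N`). -/
theorem stub_crowdedWork :
    ∀ v : ℝ → ℝ≥0∞, IsRepulsiveFiniteRange v → (∃ M : NNReal, ∀ r, v r ≤ M) →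
      ∀ rc : ℝ, 0 < rc → ∃ ρ₀ : ℝ, 0 < ρ₀ ∧ ∀ ρ : ℝ, 0 < ρ → ρ < ρ₀ → ∃ C : ℝ,
      ∀ᶠ m : ℕ in atTop, ∀ Ψ : PeriodicTrialState (m + 2) (sideLength ρ (m + 2)),
      periodicEnergy v Ψ = periodicGroundStateEnergy v (m + 2) (sideLength ρ (m + 2)) →
      (∀ X, 0 < (Ψ.ψ X).re ∧ (Ψ.ψ X).im = 0) →
      (∀ (a : Space) (X : Config (m + 2)), Ψ.ψ (fun i => X i + a) = Ψ.ψ X) →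
      ∀ x y : Space,
        (∫ Y in cellN (m + 1) (sideLength ρ (m + 2)) \
            {Y | ∀ (j : Fin (m + 1)) (n : Fin 3 → ℤ),
              rc ≤ ‖Y j - x - latticeVec (sideLength ρ (m + 2)) n‖ ∧
                rc ≤ ‖Y j - y - latticeVec (sideLength ρ (m + 2)) n‖},
          (Ψ.ψ (Matrix.vecCons x Y)).re ^ 2 *
            ((Real.log ((Ψ.ψ (Matrix.vecCons x Y)).re) - Real.log ((Ψ.ψ (Matrix.vecCons y Y)).re)) -
              ∑ j : Fin (m + 1),
                ((ρ / ((m : ℝ) + 2)) ^ m *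
                    (∫ W in cellN m (sideLength ρ (m + 2)),
                      -Real.log ((Ψ.ψ (Matrix.vecCons y (Matrix.vecCons (Y j) W))).re)) -
                  (ρ / ((m : ℝ) + 2)) ^ m *
                    (∫ W in cellN m (sideLength ρ (m + 2)),
                      -Real.log ((Ψ.ψ (Matrix.vecCons x (Matrix.vecCons (Y j) W))).re))))) ≤
          C * ∫ Y in cellN (m + 1) (sideLength ρ (m + 2)), (Ψ.ψ (Matrix.vecCons x Y)).re ^ 2 := by
  sorry

/-! ## The composition (kernel-checked, no `sorry` of its own) -/

/-- Periodic isolation events are measurable (countable intersection of closed super-level sets of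
continuous functions). [folklore] -/
theorem measurableSet_isolated (k : ℕ) (rc L : ℝ) (x y : Space) :
    MeasurableSet {Y : Config k | ∀ (j : Fin k) (n : Fin 3 → ℤ),
      rc ≤ ‖Y j - x - latticeVec L n‖ ∧ rc ≤ ‖Y j - y - latticeVec L n‖} := by
  simp only [Set.setOf_forall, Set.setOf_and]
  refine MeasurableSet.iInter fun j => MeasurableSet.iInter fun n => ?_
  exact (measurableSet_le measurable_const (by fun_prop)).inter
    (measurableSet_le measurable_const (by fun_prop))

/-- Real-analysis seam of the line: one-sided bounds for a real set integral on `s ∩ t` and on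
`s ∖ t` with a common nonnegative scale `Z` give the bound on `s` with constant `|C₁| + |C₂|` —
by additivity when the integrand is integrable on `s`, and by the Bochner junk value `∫ = 0`
otherwise. [folklore] -/
theorem setIntegral_le_of_inter_sdiff {α : Type*} [MeasurableSpace α] {μ : Measure α}
    {f : α → ℝ} {s t : Set α} {Z C₁ C₂ : ℝ} (ht : MeasurableSet t) (hZ : 0 ≤ Z)
    (h₁ : ∫ a in s ∩ t, f a ∂μ ≤ C₁ * Z) (h₂ : ∫ a in s \ t, f a ∂μ ≤ C₂ * Z) :
    ∫ a in s, f a ∂μ ≤ (|C₁| + |C₂|) * Z := by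
  by_cases hf : IntegrableOn f s μ
  · rw [← integral_inter_add_sdiff ht hf, add_mul]
    exact add_le_add (h₁.trans (mul_le_mul_of_nonneg_right (le_abs_self C₁) hZ))
      (h₂.trans (mul_le_mul_of_nonneg_right (le_abs_self C₂) hZ))
  · rw [integral_undef hf]
    exact mul_nonneg (add_nonneg (abs_nonneg C₁) (abs_nonneg C₂)) hZ

/-- **`BeyondPairGhostWork` from the two stub STATEMENTS** — the crux BY NAME
(`Summit.AtomisticToContinuum.BoseEinsteinCondensation.Theses.BECRiccatiGhostPlasma.BeyondPairGhostWork`)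
from the cavity stub and the crowded stub as hypotheses; no `sorry`. Proof: cavity radius `rc` from
Stub 1, Stub 2 instantiated at that `rc`; `ρ₀ := min ρ₀¹ ρ₀²`; at `ρ < ρ₀`, `C := |C₁| + |C₂|`;
eventually in `m` (intersection of the two `atTop` sets), for every admissible `Ψ, x, y` the bath
cell splits as `(cell^(m+1) ∩ I_rc) ∪ (cell^(m+1) ∖ I_rc)` (measurable: `measurableSet_isolated`),
and `setIntegral_le_of_inter_sdiff` adds the two one-sided bounds against the nonnegative slice
mass `Z`. [folklore] -/
theorem BeyondPairGhostWork_of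
    (hfar : ∀ v : ℝ → ℝ≥0∞, IsRepulsiveFiniteRange v → (∃ M : NNReal, ∀ r, v r ≤ M) →
      ∃ rc : ℝ, 0 < rc ∧ ∃ ρ₀ : ℝ, 0 < ρ₀ ∧ ∀ ρ : ℝ, 0 < ρ → ρ < ρ₀ → ∃ C : ℝ,
      ∀ᶠ m : ℕ in atTop, ∀ Ψ : PeriodicTrialState (m + 2) (sideLength ρ (m + 2)),
      periodicEnergy v Ψ = periodicGroundStateEnergy v (m + 2) (sideLength ρ (m + 2)) →
      (∀ X, 0 < (Ψ.ψ X).re ∧ (Ψ.ψ X).im = 0) →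
      (∀ (a : Space) (X : Config (m + 2)), Ψ.ψ (fun i => X i + a) = Ψ.ψ X) →
      ∀ x y : Space,
        (∫ Y in cellN (m + 1) (sideLength ρ (m + 2)) ∩
            {Y | ∀ (j : Fin (m + 1)) (n : Fin 3 → ℤ),
              rc ≤ ‖Y j - x - latticeVec (sideLength ρ (m + 2)) n‖ ∧
                rc ≤ ‖Y j - y - latticeVec (sideLength ρ (m + 2)) n‖},
          (Ψ.ψ (Matrix.vecCons x Y)).re ^ 2 *
            ((Real.log ((Ψ.ψ (Matrix.vecCons x Y)).re) - Real.log ((Ψ.ψ (Matrix.vecCons y Y)).re)) -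
              ∑ j : Fin (m + 1),
                ((ρ / ((m : ℝ) + 2)) ^ m *
                    (∫ W in cellN m (sideLength ρ (m + 2)),
                      -Real.log ((Ψ.ψ (Matrix.vecCons y (Matrix.vecCons (Y j) W))).re)) -
                  (ρ / ((m : ℝ) + 2)) ^ m *
                    (∫ W in cellN m (sideLength ρ (m + 2)),
                      -Real.log ((Ψ.ψ (Matrix.vecCons x (Matrix.vecCons (Y j) W))).re))))) ≤
          C * ∫ Y in cellN (m + 1) (sideLength ρ (m + 2)), (Ψ.ψ (Matrix.vecCons x Y)).re ^ 2)
    (hnear : ∀ v : ℝ → ℝ≥0∞, IsRepulsiveFiniteRange v → (∃ M : NNReal, ∀ r, v r ≤ M) →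
      ∀ rc : ℝ, 0 < rc → ∃ ρ₀ : ℝ, 0 < ρ₀ ∧ ∀ ρ : ℝ, 0 < ρ → ρ < ρ₀ → ∃ C : ℝ,
      ∀ᶠ m : ℕ in atTop, ∀ Ψ : PeriodicTrialState (m + 2) (sideLength ρ (m + 2)),
      periodicEnergy v Ψ = periodicGroundStateEnergy v (m + 2) (sideLength ρ (m + 2)) →
      (∀ X, 0 < (Ψ.ψ X).re ∧ (Ψ.ψ X).im = 0) →
      (∀ (a : Space) (X : Config (m + 2)), Ψ.ψ (fun i => X i + a) = Ψ.ψ X) →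
      ∀ x y : Space,
        (∫ Y in cellN (m + 1) (sideLength ρ (m + 2)) \
            {Y | ∀ (j : Fin (m + 1)) (n : Fin 3 → ℤ),
              rc ≤ ‖Y j - x - latticeVec (sideLength ρ (m + 2)) n‖ ∧
                rc ≤ ‖Y j - y - latticeVec (sideLength ρ (m + 2)) n‖},
          (Ψ.ψ (Matrix.vecCons x Y)).re ^ 2 *
            ((Real.log ((Ψ.ψ (Matrix.vecCons x Y)).re) - Real.log ((Ψ.ψ (Matrix.vecCons y Y)).re)) -
              ∑ j : Fin (m + 1),
                ((ρ / ((m : ℝ) + 2)) ^ m *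
                    (∫ W in cellN m (sideLength ρ (m + 2)),
                      -Real.log ((Ψ.ψ (Matrix.vecCons y (Matrix.vecCons (Y j) W))).re)) -
                  (ρ / ((m : ℝ) + 2)) ^ m *
                    (∫ W in cellN m (sideLength ρ (m + 2)),
                      -Real.log ((Ψ.ψ (Matrix.vecCons x (Matrix.vecCons (Y j) W))).re))))) ≤
          C * ∫ Y in cellN (m + 1) (sideLength ρ (m + 2)), (Ψ.ψ (Matrix.vecCons x Y)).re ^ 2) :
    Theses.BECRiccatiGhostPlasma.BeyondPairGhostWork := by
  intro v hv hb
  obtain ⟨rc, hrc, ρ₁, hρ₁, h₁⟩ := hfar v hv hb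
  obtain ⟨ρ₂, hρ₂, h₂⟩ := hnear v hv hb rc hrc
  refine ⟨min ρ₁ ρ₂, lt_min hρ₁ hρ₂, fun ρ hρ hρlt => ?_⟩
  obtain ⟨C₁, hC₁⟩ := h₁ ρ hρ (lt_of_lt_of_le hρlt (min_le_left _ _))
  obtain ⟨C₂, hC₂⟩ := h₂ ρ hρ (lt_of_lt_of_le hρlt (min_le_right _ _))
  refine ⟨|C₁| + |C₂|, ?_⟩
  filter_upwards [hC₁, hC₂] with m hm₁ hm₂
  intro Ψ hE hpos htr x y
  have e₁ := hm₁ Ψ hE hpos htr x y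
  have e₂ := hm₂ Ψ hE hpos htr x y
  have hZ : 0 ≤ ∫ Y in cellN (m + 1) (sideLength ρ (m + 2)), (Ψ.ψ (Matrix.vecCons x Y)).re ^ 2 :=
    integral_nonneg fun Y => sq_nonneg _
  exact setIntegral_le_of_inter_sdiff (measurableSet_isolated (m + 1) rc (sideLength ρ (m + 2)) x y)
    hZ e₁ e₂

/-- **`BeyondPairGhostWork` from the two REGISTERED stubs** — the crux by name, fed with
`stub_cavityWork` and `stub_crowdedWork`; its only `sorry`s are theirs, so it closes the crux the day
both stubs are theorems. [folklore] -/
theorem BeyondPairGhostWork_of_stubs : Theses.BECRiccatiGhostPlasma.BeyondPairGhostWork :=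
  BeyondPairGhostWork_of stub_cavityWork stub_crowdedWork

end Summit.AtomisticToContinuum.BoseEinsteinCondensation.Cruxes.BeyondPairGhostWork.BirthCavitySplit

end
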